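import Summits.MatrixMultiplication.OmegaCensus.STPPVosperSlackOneCoverSteps

/-!
# ω-census (abelian STPP census): case-α₂ row checks for `{(2,3,5),(2,3,5)} ⊄ ℤ₅₉` — ratio `j = 3` (kernel computations)

HONEST FRAMING (pub-omega census; verbatim): lottery ticket; floor = certified bounds/negative ranges.
Census STRUCTURE (seat pub-omega-stpp-2 gen 25, 2026-08-28), family (b2).  Row file for the kill `STPPVosperCoverKill235Z59.lean`: reading `(a,b,c) = (2,3,5)`
at block `0`, other block `(2,3,5)`, `(n+1, L, b, z) = (47, 15, 3, 10)`, word target `{0, ±1, ±2}`.  For the ratios of this file the α₂ row checker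
`alpha2RowOK` (`STPPVosperSlackOneCoverSteps.lean`) is `true` because NO pair of run starts passes the window and prefix tests (the cost is the prefix test on
every window-admissible pair; files are split so that each `decide` stays small) — except `j = 5, 54`, whose two admissible offsets at `ℓ₁ = 7` have failing
Z-first cover searches.  Nothing here is progress on `ω`.
-/

open Finset

namespace Summit.MatrixMultiplication.OmegaCensus.CubeNB

/-- α₂ row check, `j = 3`, `ℓ₁ = 1`. [folklore] -/
theorem a2row59_235_j3_l1 : alpha2RowOK 59 47 15 3 {0, 1, 58, 2, 57} 10 [(2, 3, 5)] [(3, 2, 5)] true 3 1 = true := by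
  decide +kernel

/-- α₂ row check, `j = 3`, `ℓ₁ = 2`. [folklore] -/
theorem a2row59_235_j3_l2 : alpha2RowOK 59 47 15 3 {0, 1, 58, 2, 57} 10 [(2, 3, 5)] [(3, 2, 5)] true 3 2 = true := by
  decide +kernel

/-- α₂ row check, `j = 3`, `ℓ₁ = 3`. [folklore] -/
theorem a2row59_235_j3_l3 : alpha2RowOK 59 47 15 3 {0, 1, 58, 2, 57} 10 [(2, 3, 5)] [(3, 2, 5)] true 3 3 = true := by
  decide +kernel

/-- α₂ row check, `j = 3`, `ℓ₁ = 4`. [folklore] -/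
theorem a2row59_235_j3_l4 : alpha2RowOK 59 47 15 3 {0, 1, 58, 2, 57} 10 [(2, 3, 5)] [(3, 2, 5)] true 3 4 = true := by
  decide +kernel

/-- α₂ row check, `j = 3`, `ℓ₁ = 5`. [folklore] -/
theorem a2row59_235_j3_l5 : alpha2RowOK 59 47 15 3 {0, 1, 58, 2, 57} 10 [(2, 3, 5)] [(3, 2, 5)] true 3 5 = true := by
  decide +kernel

/-- α₂ row check, `j = 3`, `ℓ₁ = 6`. [folklore] -/
theorem a2row59_235_j3_l6 : alpha2RowOK 59 47 15 3 {0, 1, 58, 2, 57} 10 [(2, 3, 5)] [(3, 2, 5)] true 3 6 = true := by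
  decide +kernel

/-- α₂ row check, `j = 3`, `ℓ₁ = 7`. [folklore] -/
theorem a2row59_235_j3_l7 : alpha2RowOK 59 47 15 3 {0, 1, 58, 2, 57} 10 [(2, 3, 5)] [(3, 2, 5)] true 3 7 = true := by
  decide +kernel

/-- α₂ row checks, `j = 3`, all `ℓ₁ < 8`. [folklore] -/
theorem a2row59_235_j3_all : ∀ ℓ₁ < 8, ℓ₁ = 0 ∨ alpha2RowOK 59 47 15 3 {0, 1, 58, 2, 57} 10 [(2, 3, 5)] [(3, 2, 5)] true 3 ℓ₁ = true := by
  intro ℓ₁ h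
  interval_cases ℓ₁
  · exact Or.inl rfl
  · exact Or.inr a2row59_235_j3_l1
  · exact Or.inr a2row59_235_j3_l2
  · exact Or.inr a2row59_235_j3_l3
  · exact Or.inr a2row59_235_j3_l4
  · exact Or.inr a2row59_235_j3_l5
  · exact Or.inr a2row59_235_j3_l6
  · exact Or.inr a2row59_235_j3_l7

end Summit.MatrixMultiplication.OmegaCensus.CubeNB
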